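import Summits.Ventures.PercRepro.MSTightTwoFamilySplit

/-!
# A two-family Marica–Schönheim inequality, and the excess of the halves of a family

Dossier proofs/MINE1-theoremS.md, Addendum 49. For families `A, B, C, A', C'` of finite sets
(`S \\ T = {s \ t : s ∈ S, t ∈ T}`, `D(S) = S \\ S`):

**Theorem** (`marica_schonheim_two_family`)
`|B \\ A| + |A' \\ B| + |D(B) \ (C \\ A ∪ A' \\ C')| ≥ |B|`.

Special cases: `A' = ∅` gives `|B \\ A| + |D(B) \ (C \\ A)| ≥ |B|`; `A = ∅` gives the mirror
`|A' \\ B| + |D(B) \ (A' \\ C')| ≥ |B|`; `C = A` gives `|B \\ A| + |D(B) \ D(A)| ≥ |B|` and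
`|A \\ B| + |D(B) \ D(A)| ≥ |B|`; `A = A' = ∅` is Marica–Schönheim `|D(B)| ≥ |B|`.

The proof is an induction on the ground set in the style of Ahlswede–Daykin's two-family
Marica–Schönheim theorem (Ahlswede–Blinovsky, Lectures on Advances in Combinatorics, Lecture 15,
Theorem 37): for an element `r`, every difference family splits into its `r`-free part and its
`r`-part (`part0_diffs`, `partr_diffs` of `MSTightTwoFamilySplit`); the induction hypothesis is applied to the projections
(`proj r _`) and to the partner family `partner r B = B₀ ∩ B₁`; the three lifting inequalities
`lift_diffs_left`, `lift_diffs_right`, `lift_sdiff` recover the count on the larger ground set.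

For a family `F` and an element `r` (`F₀ = part0 r F`, `F₁ = partr r F`, `X = diffsX r F`,
`Y = diffsY r F`, `|D(F)| = |X| + |Y|`) the corollaries read
`|D(F₀)| + |F₁| + |X \ (D(F₀) ∪ D(F₁))| ≤ |D(F)|` and `|D(F₁)| + |F₀| + |X \ (D(F₀) ∪ D(F₁))| ≤ |D(F)|`
(`card_diffs_part0_add_card_partr_le`, `card_diffs_partr_add_card_part0_le`): **the excess
`|D(G)| − |G|` of a family dominates the excess of each of its two halves** — for every family and
every direction (the inequality (HX) of Addendum 48 suppl. 1 (iii) without the trace term, and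
(H8) at a tightening direction of an excess-one family).
-/

namespace PercRepro.MSTight

open Finset
open scoped FinsetFamily

variable {α : Type*} [DecidableEq α]

/-- **Lifting `B \\ A`**: `|proj B \\ proj A| + |partner B \\ part0 A| ≤ |B \\ A|`. -/
theorem lift_diffs_left (r : α) (A B : Finset (Finset α)) :
    (proj r B \\ proj r A).card + (partner r B \\ part0 r A).card ≤ (B \\ A).card := by
  rw [diffs_proj_eq₂, card_diffs_eq_card_X₂_add_card_Y₂ r B A,
    ← Finset.card_union_add_card_inter (diffsX₂ r B A) (diffsY₂ r B A)]
  apply Nat.add_le_add_left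
  apply Finset.card_le_card
  intro E hE
  obtain ⟨K, hK, a, ha, rfl⟩ := Finset.mem_diffs.1 hE
  rw [partner, Finset.mem_inter] at hK
  refine Finset.mem_inter.2 ⟨?_, ?_⟩
  · exact Finset.mem_union.2 (Or.inl (Finset.mem_union.2 (Or.inl
      (Finset.mem_diffs.2 ⟨K, hK.1, a, ha, rfl⟩))))
  · exact Finset.mem_diffs.2 ⟨K, hK.2, a, ha, rfl⟩

/-- **Lifting `A' \\ B`**: `|proj A' \\ proj B| + |partr A' \\ partner B| ≤ |A' \\ B|`. -/
theorem lift_diffs_right (r : α) (A' B : Finset (Finset α)) :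
    (proj r A' \\ proj r B).card + (partr r A' \\ partner r B).card ≤ (A' \\ B).card := by
  rw [diffs_proj_eq₂, card_diffs_eq_card_X₂_add_card_Y₂ r A' B,
    ← Finset.card_union_add_card_inter (diffsX₂ r A' B) (diffsY₂ r A' B)]
  apply Nat.add_le_add_left
  apply Finset.card_le_card
  intro E hE
  obtain ⟨a, ha, K, hK, rfl⟩ := Finset.mem_diffs.1 hE
  rw [partner, Finset.mem_inter] at hK
  refine Finset.mem_inter.2 ⟨?_, ?_⟩
  · exact Finset.mem_union.2 (Or.inl (Finset.mem_union.2 (Or.inr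
      (Finset.mem_diffs.2 ⟨a, ha, K, hK.2, rfl⟩))))
  · exact Finset.mem_diffs.2 ⟨a, ha, K, hK.1, rfl⟩

/-- **Lifting the difference family minus a family `W`**: with `K = partner r B`,
`|(X ∪ Y) \ (W₀ ∪ W₁)| + |(K \\ K) \ W₁| ≤ |X \ W₀| + |Y \ W₁| = |D(B) \ W|`. -/
theorem lift_sdiff (r : α) (B W : Finset (Finset α)) :
    ((diffsX r B ∪ diffsY r B) \ (part0 r W ∪ partr r W)).card +
      ((partner r B \\ partner r B) \ partr r W).card ≤ ((B \\ B) \ W).card := by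
  rw [card_eq_card_part0_add_card_partr r ((B \\ B) \ W), part0_sdiff, partr_sdiff,
    part0_diffs, partr_diffs, diffsX₂_self, diffsY₂_self]
  have hKX : partner r B \\ partner r B ⊆ diffsX r B := by
    intro E hE
    obtain ⟨K, hK, K', hK', rfl⟩ := Finset.mem_diffs.1 hE
    rw [partner, Finset.mem_inter] at hK hK'
    exact Finset.mem_union.2 (Or.inl (Finset.mem_union.2 (Or.inl
      (Finset.mem_diffs.2 ⟨K, hK.1, K', hK'.1, rfl⟩))))
  have hKY : partner r B \\ partner r B ⊆ diffsY r B := by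
    intro E hE
    obtain ⟨K, hK, K', hK', rfl⟩ := Finset.mem_diffs.1 hE
    rw [partner, Finset.mem_inter] at hK hK'
    exact Finset.mem_diffs.2 ⟨K, hK.2, K', hK'.1, rfl⟩
  have e1 := Finset.card_union_add_card_inter
    ((diffsX r B ∪ diffsY r B) \ (part0 r W ∪ partr r W))
    ((partner r B \\ partner r B) \ partr r W)
  have e2 := Finset.card_union_add_card_inter (diffsX r B \ part0 r W) (diffsY r B \ partr r W)
  have i1 : ((diffsX r B ∪ diffsY r B) \ (part0 r W ∪ partr r W) ∪
      (partner r B \\ partner r B) \ partr r W).card ≤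
      (diffsX r B \ part0 r W ∪ diffsY r B \ partr r W).card := by
    apply Finset.card_le_card
    intro E hE
    rcases Finset.mem_union.1 hE with h | h
    · rw [Finset.mem_sdiff, Finset.mem_union, Finset.mem_union] at h
      rw [Finset.mem_union, Finset.mem_sdiff, Finset.mem_sdiff]
      tauto
    · rw [Finset.mem_sdiff] at h
      exact Finset.mem_union.2 (Or.inr (Finset.mem_sdiff.2 ⟨hKY h.1, h.2⟩))
  have i2 : ((diffsX r B ∪ diffsY r B) \ (part0 r W ∪ partr r W) ∩
      ((partner r B \\ partner r B) \ partr r W)).card ≤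
      (diffsX r B \ part0 r W ∩ (diffsY r B \ partr r W)).card := by
    apply Finset.card_le_card
    intro E hE
    rw [Finset.mem_inter, Finset.mem_sdiff, Finset.mem_sdiff, Finset.mem_union] at hE
    rw [Finset.mem_inter, Finset.mem_sdiff, Finset.mem_sdiff]
    exact ⟨⟨hKX hE.2.1, fun h => hE.1.2 (Finset.mem_union.2 (Or.inl h))⟩, hKY hE.2.1, hE.2.2⟩
  omega

/-- The inductive statement: the two-family inequality for families whose members lie in `U`. -/
theorem marica_schonheim_two_family_aux (U : Finset α) :
    ∀ (A B C A' C' : Finset (Finset α)), (∀ b ∈ B, b ⊆ U) →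
      B.card ≤ (B \\ A).card + (A' \\ B).card + ((B \\ B) \ (C \\ A ∪ A' \\ C')).card := by
  induction U using Finset.induction_on with
  | empty =>
    intro A B C A' C' hB
    rcases B.eq_empty_or_nonempty with rfl | hBne
    · simp
    · have hB1 : B = {∅} := by
        apply hBne.subset_singleton_iff.1
        intro b hb
        rw [Finset.mem_singleton]
        exact Finset.subset_empty.1 (hB b hb)
      have hcard : B.card = 1 := by rw [hB1]; simp
      rw [hcard]
      by_cases hA : A = ∅
      · by_cases hA' : A' = ∅
        · subst hA; subst hA'
          simp only [Finset.diffs_empty, Finset.empty_sdiffs, Finset.card_empty,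
            Finset.union_empty, Finset.sdiff_empty, zero_add]
          exact Finset.card_pos.2 (hBne.diffs hBne)
        · have : 0 < (A' \\ B).card :=
            Finset.card_pos.2 ((Finset.nonempty_iff_ne_empty.2 hA').diffs hBne)
          omega
      · have : 0 < (B \\ A).card :=
          Finset.card_pos.2 (hBne.diffs (Finset.nonempty_iff_ne_empty.2 hA))
        omega
  | insert r U' hr ih =>
    intro A B C A' C' hB
    -- the induction hypothesis on the projections
    have ih1 := ih (proj r A) (proj r B) (proj r C) (proj r A') (proj r C')
      (proj_subset_of_subset_insert hr hB)
    -- the induction hypothesis on the partner family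
    have ih2 := ih (part0 r A) (partner r B) (partr r C) (partr r A') (part0 r C')
      (partner_subset_of_subset_insert hB)
    -- the subtracted family, split
    set W : Finset (Finset α) := C \\ A ∪ A' \\ C' with hW
    have hW0 : part0 r W = diffsX₂ r C A ∪ diffsX₂ r A' C' := by
      rw [hW, part0_union, part0_diffs, part0_diffs]
    have hW1 : partr r W = diffsY₂ r C A ∪ diffsY₂ r A' C' := by
      rw [hW, partr_union, partr_diffs, partr_diffs]
    have hsub1 : proj r C \\ proj r A ∪ proj r A' \\ proj r C' = part0 r W ∪ partr r W := by
      rw [hW0, hW1, diffs_proj_eq₂, diffs_proj_eq₂]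
      ext E
      simp only [Finset.mem_union]
      tauto
    have hsub2 : partr r C \\ part0 r A ∪ partr r A' \\ part0 r C' = partr r W := by
      rw [hW1, diffsY₂, diffsY₂]
    rw [diffs_proj_eq (r := r), hsub1] at ih1
    rw [hsub2] at ih2
    have l1 := lift_diffs_left r A B
    have l2 := lift_diffs_right r A' B
    have l3 := lift_sdiff r B W
    have hcard := card_eq_card_proj_add_card_partner r B
    omega

/-- **A two-family Marica–Schönheim inequality.** For all finite families `A, B, C, A', C'`,
`|B \\ A| + |A' \\ B| + |D(B) \ (C \\ A ∪ A' \\ C')| ≥ |B|`. -/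
theorem marica_schonheim_two_family (A B C A' C' : Finset (Finset α)) :
    B.card ≤ (B \\ A).card + (A' \\ B).card + ((B \\ B) \ (C \\ A ∪ A' \\ C')).card :=
  marica_schonheim_two_family_aux (B.biUnion id) A B C A' C'
    (fun _ hb => Finset.subset_biUnion_of_mem id hb)

/-- `|B \\ A| + |D(B) \ (C \\ A)| ≥ |B|`. -/
theorem card_le_card_diffs_add_card_sdiff_diffs (A B C : Finset (Finset α)) :
    B.card ≤ (B \\ A).card + ((B \\ B) \ (C \\ A)).card := by
  have h := marica_schonheim_two_family A B C ∅ ∅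
  simpa using h

/-- `|A \\ B| + |D(B) \ (A \\ C)| ≥ |B|`. -/
theorem card_le_card_diffs_add_card_sdiff_diffs' (A B C : Finset (Finset α)) :
    B.card ≤ (A \\ B).card + ((B \\ B) \ (A \\ C)).card := by
  have h := marica_schonheim_two_family ∅ B ∅ A C
  simpa using h

/-- `|B \\ A| + |D(B) \ D(A)| ≥ |B|`. -/
theorem card_le_card_diffs_add_card_diffs_sdiff_diffs (A B : Finset (Finset α)) :
    B.card ≤ (B \\ A).card + ((B \\ B) \ (A \\ A)).card :=
  card_le_card_diffs_add_card_sdiff_diffs A B A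

/-- `|A \\ B| + |D(B) \ D(A)| ≥ |B|`. -/
theorem card_le_card_diffs_add_card_diffs_sdiff_diffs' (A B : Finset (Finset α)) :
    B.card ≤ (A \\ B).card + ((B \\ B) \ (A \\ A)).card :=
  card_le_card_diffs_add_card_sdiff_diffs' A B A

/-- `X ⊇ D(F₀) ∪ D(F₁)`. -/
theorem diffs_part0_union_diffs_partr_subset_diffsX (r : α) (F : Finset (Finset α)) :
    part0 r F \\ part0 r F ∪ partr r F \\ partr r F ⊆ diffsX r F :=
  Finset.subset_union_left

/-- **The excess of `F` dominates the excess of its `r`-free half**: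
`|D(F₀)| + |F₁| + |X \ (D(F₀) ∪ D(F₁))| ≤ |D(F)|` (so `|D(F₀)| − |F₀| ≤ |D(F)| − |F|`). -/
theorem card_diffs_part0_add_card_partr_le (r : α) (F : Finset (Finset α)) :
    (part0 r F \\ part0 r F).card + (partr r F).card +
      (diffsX r F \ (part0 r F \\ part0 r F ∪ partr r F \\ partr r F)).card ≤ (F \\ F).card := by
  have h := card_le_card_diffs_add_card_diffs_sdiff_diffs (part0 r F) (partr r F)
  rw [card_diffs_eq_card_X_add_card_Y r F]
  have hZ := Finset.card_sdiff_add_card_eq_card (diffs_part0_union_diffs_partr_subset_diffsX r F)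
  have h1 := Finset.card_sdiff_add_card (partr r F \\ partr r F) (part0 r F \\ part0 r F)
  rw [Finset.union_comm] at h1
  unfold diffsY at h ⊢
  omega

/-- **The excess of `F` dominates the excess of its `r`-half**:
`|D(F₁)| + |F₀| + |X \ (D(F₀) ∪ D(F₁))| ≤ |D(F)|` (so `|D(F₁)| − |F₁| ≤ |D(F)| − |F|`). -/
theorem card_diffs_partr_add_card_part0_le (r : α) (F : Finset (Finset α)) :
    (partr r F \\ partr r F).card + (part0 r F).card +
      (diffsX r F \ (part0 r F \\ part0 r F ∪ partr r F \\ partr r F)).card ≤ (F \\ F).card := by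
  have h := card_le_card_diffs_add_card_diffs_sdiff_diffs' (partr r F) (part0 r F)
  rw [card_diffs_eq_card_X_add_card_Y r F]
  have hZ := Finset.card_sdiff_add_card_eq_card (diffs_part0_union_diffs_partr_subset_diffsX r F)
  have h1 := Finset.card_sdiff_add_card (part0 r F \\ part0 r F) (partr r F \\ partr r F)
  unfold diffsY at h ⊢
  omega

/-- Marica–Schönheim as the case `A = A' = ∅` (Mathlib's `Finset.card_le_card_diffs`). -/
theorem card_le_card_diffs_of_two_family (B : Finset (Finset α)) : B.card ≤ (B \\ B).card := by
  have h := marica_schonheim_two_family ∅ B ∅ ∅ ∅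
  simpa using h

end PercRepro.MSTight
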